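import Summits.BirchSwinnertonDyer.BirchSwinnertonDyer.Theorems.EisensteinPrimesBSDpOnCellCTelescopeCarrierSplit
import Mathlib.Data.Nat.Nth
import HarnessLib
/-!
# [telescope v16 — successor LEAD cruxlead-19034 g4, 2026-08-30] PREFIX⁺ RE-PORT: the road-prefix package of the leaves gains two trailing conjuncts,
# (wt) `∃ M, ∀ k, (p : ℤ_[p])^M * x k = ((D k).k − 2 : ℤ)` (the chart variable IS the rescaled weight — `IsPNewBranchAnalyticChart` clause (wt)) and
# (rat) `∀ k, Function.Surjective (algebraMap ℤ_[p] (padicCoeffIntegers (D k).ι))` (the members on the étale branch through the RATIONAL newform f_E are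
# ℚ_p-rational — print: Hida 1986 Cor. 1.4, Greenberg–Stevens 1993 §2, Venerucci 2016 §2.4; typer flag T1-R0), so that the construction leaf N1 no longer
# CLAIMS (rat_k) about its input (width x2-p2 g23 `N1-TYPING-x2p2g23.md`, ideator g40 `N1-PRICING.md` §0; LEAD ruling STATUS 08:45:48Z). Statement = the
# F-form original with the two conjuncts appended at EVERY occurrence of the package; proof token-identical.
# THIS FILE = the TOP GLUE `TelescopeCarrierOfAnDistOfAlgF.carrier_of_anDist_of_algF` (p762809) with the analytic package `hAn` ENRICHED by (wt) ∧ (rat) (appended after the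
# (chart) clause, inside the ∃) and the algebraic package `hAlg` on prefix⁺; the conclusion (the registered carrier text of V22's hypothesis) is UNCHANGED. The subsequence
# step is untouched: the carrier does not mention (wt)/(rat). The enriched analytic package is what a parked bridge-shaped stub of telescope v16 supplies until the typer's
# «T-An-2ʳ» lands ((wt) and (dist) are provable today from `hchart`; (rat) is the one print clause pending). (`--supports`, helper; closes nothing; THEOREMS ONLY.)
-/

set_option autoImplicit false
set_option linter.dupNamespace false

noncomputable section

open scoped Classical MatrixGroups ModularForm

open CongruenceSubgroup WeierstrassCurve NumberField IsDedekindDomain Field PowerSeries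
  Literature.NumberTheory.EllipticCurves Literature.NumberTheory.EllipticCurves.GreenbergSelmer
  Literature.NumberTheory.EllipticCurves.ModularForms Literature.NumberTheory.QuadraticFields
  Literature.NumberTheory.EllipticCurves.Rank1Residual
  Literature.NumberTheory.EllipticCurves.Rank1Residual.Typed
  Literature.NumberTheory.GaloisRepresentations Literature.NumberTheory.GaloisCohomology
  Summit.BirchSwinnertonDyer.Rank1Residual.X11b.AcSelmer
  Summit.BirchSwinnertonDyer.Rank1Residual.X11b.Halves
  Summit.BirchSwinnertonDyer.Rank1Residual.X11b
  Summit.BirchSwinnertonDyer.Rank1Residual Summit.BirchSwinnertonDyer.Rank1Residual.X1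
  Summit.BirchSwinnertonDyer.Rank1Residual.X2
open Literature.NumberTheory.EllipticCurves.BigGaloisRep
open Literature.NumberTheory.EllipticCurves.Castella2018

namespace Summit.BirchSwinnertonDyer.BirchSwinnertonDyer.Theorems.TelescopeCarrierOfAnDistRatOfAlgFP

open Summit.BirchSwinnertonDyer.BirchSwinnertonDyer.Theorems
set_option maxHeartbeats 800000 in
/-- **The registered carrier from an analytic package with (dist) and an algebraic package in F-form, along the subsequence of members off the
exceptional set.** `hAn` = the `hAn` of `TelescopeCarrierSplit.carrier_of_an_of_alg` with `(Set.range x).Infinite` added; `hAlg` = its `hAlg` with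
the member clause `∀ k, ∃ Φ, …` relaxed to `∃ bad : Set ℤ_[p], bad.Finite ∧ ∀ k, x k ∉ bad → ∃ Φ, …`; conclusion = the carrier text VERBATIM.
CONDITIONAL; nothing asserted. [cite: Castella2020JIMJ, Def. 2.10 and Thm. 2.11 (J. Inst. Math. Jussieu 19 (2020) p. 12) (shape only)]
[cite: Hida1986, Thm. I (shape only)] [claim: KellerYin2024, status: under-review] [cite: KellerYin2024, §5.1 (a)–(d) (arXiv:2402.12781v2 p. 43) (shape only)] -/
theorem carrier_of_anDistRat_of_algFP
    (hAn :
    ∀ (W : WeierstrassCurve ℚ) [W.IsElliptic] [W.IsGloballyMinimal] (p : ℕ) [Fact p.Prime],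
    ∀ (N : ℕ) [NeZero N] (K : Type) [Field K] [NumberField K] (Dt : ModularParametrizationData W N)
      (H : HeegnerDatum N (NumberField.discr K)) (ιK : K →+* ℂ) (P : (W.baseChange K).toAffine.Point),
      CellC W p → W.conductorNorm ℤ = N →
      IsImaginaryQuadratic K → NumberField.discr K < -4 → SatisfiesHeegnerHypothesis N K →
      (W.quadraticTwist (NumberField.discr K : ℚ)).entireLFunction 1 ≠ 0 →
      WeierstrassCurve.Affine.Point.map ιK.toRatAlgHom P = heegnerPointComplex Dt H →
      ¬ (p : ℤ) ∣ Dt.c → ¬ IsOfFinAddOrder P →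
      Odd (NumberField.discr K) →
      ∀ (κ : ZpExtension K p), κ.IsAnticyclotomic →
        ∀ (γ : Field.absoluteGaloisGroup K) [Fact (κ.IsTopGenerator γ)]
          (𝔭 : HeightOneSpectrum (𝓞 K)), ((p : ℕ) : 𝓞 K) ∈ 𝔭.asIdeal →
          𝔭.asIdeal.ramificationIdx (𝓞 ℚ) = 1 → 𝔭.asIdeal.inertiaDeg (𝓞 ℚ) = 1 →
          ∀ (𝔭bar : HeightOneSpectrum (𝓞 K)), ((p : ℕ) : 𝓞 K) ∈ 𝔭bar.asIdeal → 𝔭bar ≠ 𝔭 →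
            ((Ideal.span {(p : ℤ)}).primesOver (𝓞 K)).ncard = 2 →
          ∀ (f : CuspForm (CongruenceSubgroup.Gamma0 N) 2), IsNewformOf W f →
            ∀ (ι' : PadicAlgCl p ≃+* ℂ),
              (∀ (w : InfinitePlace K) (k : 𝓞 K),
                k ∈ 𝔭.asIdeal ↔ ‖ι'.symm (w.embedding (k : K))‖ < 1) →
              ∀ (ΩK : ℂ) (Ωp : ℂ_[p]) (Q : PowerSeries 𝓞_ℂ_[p]), ΩK ≠ 0 → ‖Ωp‖ = 1 →
                R1.IsBDPLFunctionInt p ι' 𝔭 κ γ f ΩK Ωp Q →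
      ∃ (L : PowerSeries (PowerSeries (unrIntegers p))) (x : ℕ → ℤ_[p]) (D : ℕ → Skinner2016.HidaCongruentForm W p 1),
        (∀ k, ‖x k‖ < 1) ∧ Filter.Tendsto x Filter.atTop (nhds 0) ∧ (Set.range x).Infinite ∧
        (∃ e : ℕ, PowerSeries.C ((p : 𝓞_ℂ_[p]) ^ e) * Q ∈
          Ideal.span {PowerSeries.map (R1.unrToCpInt p) (PowerSeries.map (PowerSeries.constantCoeff (R := unrIntegers p)) L)}) ∧
        (∀ k : ℕ, (∀ y : coeffField (D k).g, ι' ((D k).ι y) = (y : ℂ)) ∧ 2 * ((p : ℤ) - 1) ∣ (D k).k - 2 ∧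
          ∃ (ΩKg : ℂ) (Ωpg : ℂ_[p]) (Lg : UnrSeries p), ΩKg ≠ 0 ∧ ‖Ωpg‖ = 1 ∧
            IsBDPLFunctionWt ι' 𝔭 κ γ (D k).g ΩKg Ωpg Lg ∧
          ∃ Ψ : UnrSeries p,
            (∃ U : PowerSeries (PowerSeries (unrIntegers p)),
              PowerSeries.map (PowerSeries.C (R := unrIntegers p)) Ψ =
                L + PowerSeries.C (PowerSeries.X - PowerSeries.C (toUnr p (x k))) * U) ∧
            (∃ e : ℕ, PowerSeries.C ((p : 𝓞_ℂ_[p]) ^ e) * PowerSeries.map (R1.unrToCpInt p) Ψ ∈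
              Ideal.span {PowerSeries.map (R1.unrToCpInt p) Lg})) ∧
        (∃ A : ℕ → UnrSeries p, ∀ ℓ : ℕ, ℓ.Prime → ¬ ℓ ∣ N →
          (∃ U : UnrSeries p, A ℓ = PowerSeries.C (toUnr p ((W.frobeniusTrace ℓ : ℤ) : ℤ_[p])) + PowerSeries.X * U) ∧
          ∀ k : ℕ, ∃ (c : unrIntegers p) (U : UnrSeries p),
            A ℓ = PowerSeries.C c + (PowerSeries.X - PowerSeries.C (toUnr p (x k))) * U ∧
            ((c : ℂ_[p]) = algebraMap (PadicAlgCl p) ℂ_[p]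
              ((D k).ι ⟨(UpperHalfPlane.qExpansion 1 ⇑(D k).g).coeff ℓ, coeff_mem_coeffField (D k).g ℓ⟩))) ∧
        (∃ M : ℕ, ∀ k : ℕ, ((p : ℤ_[p]) ^ M) * x k = (((D k).k - 2 : ℤ) : ℤ_[p])) ∧
        (∀ k : ℕ, Function.Surjective (algebraMap ℤ_[p] (padicCoeffIntegers (D k).ι))))
    (hAlg :
    ∀ (W : WeierstrassCurve ℚ) [W.IsElliptic] [W.IsGloballyMinimal] (p : ℕ) [Fact p.Prime],
    ∀ (N : ℕ) [NeZero N] (K : Type) [Field K] [NumberField K] (Dt : ModularParametrizationData W N)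
      (H : HeegnerDatum N (NumberField.discr K)) (ιK : K →+* ℂ) (P : (W.baseChange K).toAffine.Point),
      CellC W p → W.conductorNorm ℤ = N →
      IsImaginaryQuadratic K → NumberField.discr K < -4 → SatisfiesHeegnerHypothesis N K →
      (W.quadraticTwist (NumberField.discr K : ℚ)).entireLFunction 1 ≠ 0 →
      WeierstrassCurve.Affine.Point.map ιK.toRatAlgHom P = heegnerPointComplex Dt H →
      ¬ (p : ℤ) ∣ Dt.c → ¬ IsOfFinAddOrder P →
      Odd (NumberField.discr K) →
      ∀ (κ : ZpExtension K p), κ.IsAnticyclotomic →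
        ∀ (γ : Field.absoluteGaloisGroup K) [Fact (κ.IsTopGenerator γ)]
          (𝔭 : HeightOneSpectrum (𝓞 K)), ((p : ℕ) : 𝓞 K) ∈ 𝔭.asIdeal →
          𝔭.asIdeal.ramificationIdx (𝓞 ℚ) = 1 → 𝔭.asIdeal.inertiaDeg (𝓞 ℚ) = 1 →
          ∀ (𝔭bar : HeightOneSpectrum (𝓞 K)), ((p : ℕ) : 𝓞 K) ∈ 𝔭bar.asIdeal → 𝔭bar ≠ 𝔭 →
            ((Ideal.span {(p : ℤ)}).primesOver (𝓞 K)).ncard = 2 →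
          ∀ (f : CuspForm (CongruenceSubgroup.Gamma0 N) 2), IsNewformOf W f →
            ∀ (ι' : PadicAlgCl p ≃+* ℂ),
              (∀ (w : InfinitePlace K) (k : 𝓞 K),
                k ∈ 𝔭.asIdeal ↔ ‖ι'.symm (w.embedding (k : K))‖ < 1) →
              ∀ (ΩK : ℂ) (Ωp : ℂ_[p]) (Q : PowerSeries 𝓞_ℂ_[p]), ΩK ≠ 0 → ‖Ωp‖ = 1 →
                R1.IsBDPLFunctionInt p ι' 𝔭 κ γ f ΩK Ωp Q →
      ∀ (L : PowerSeries (PowerSeries (unrIntegers p))) (x : ℕ → ℤ_[p]) (D : ℕ → Skinner2016.HidaCongruentForm W p 1),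
        (∀ k, ‖x k‖ < 1) ∧ Filter.Tendsto x Filter.atTop (nhds 0) ∧
        (∃ e : ℕ, PowerSeries.C ((p : 𝓞_ℂ_[p]) ^ e) * Q ∈
          Ideal.span {PowerSeries.map (R1.unrToCpInt p) (PowerSeries.map (PowerSeries.constantCoeff (R := unrIntegers p)) L)}) ∧
        (∀ k : ℕ, (∀ y : coeffField (D k).g, ι' ((D k).ι y) = (y : ℂ)) ∧ 2 * ((p : ℤ) - 1) ∣ (D k).k - 2 ∧
          ∃ (ΩKg : ℂ) (Ωpg : ℂ_[p]) (Lg : UnrSeries p), ΩKg ≠ 0 ∧ ‖Ωpg‖ = 1 ∧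
            IsBDPLFunctionWt ι' 𝔭 κ γ (D k).g ΩKg Ωpg Lg ∧
          ∃ Ψ : UnrSeries p,
            (∃ U : PowerSeries (PowerSeries (unrIntegers p)),
              PowerSeries.map (PowerSeries.C (R := unrIntegers p)) Ψ =
                L + PowerSeries.C (PowerSeries.X - PowerSeries.C (toUnr p (x k))) * U) ∧
            (∃ e : ℕ, PowerSeries.C ((p : 𝓞_ℂ_[p]) ^ e) * PowerSeries.map (R1.unrToCpInt p) Ψ ∈
              Ideal.span {PowerSeries.map (R1.unrToCpInt p) Lg})) ∧
        (∃ A : ℕ → UnrSeries p, ∀ ℓ : ℕ, ℓ.Prime → ¬ ℓ ∣ N →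
          (∃ U : UnrSeries p, A ℓ = PowerSeries.C (toUnr p ((W.frobeniusTrace ℓ : ℤ) : ℤ_[p])) + PowerSeries.X * U) ∧
          ∀ k : ℕ, ∃ (c : unrIntegers p) (U : UnrSeries p),
            A ℓ = PowerSeries.C c + (PowerSeries.X - PowerSeries.C (toUnr p (x k))) * U ∧
            ((c : ℂ_[p]) = algebraMap (PadicAlgCl p) ℂ_[p]
              ((D k).ι ⟨(UpperHalfPlane.qExpansion 1 ⇑(D k).g).coeff ℓ, coeff_mem_coeffField (D k).g ℓ⟩))) ∧
        (∃ M : ℕ, ∀ k : ℕ, ((p : ℤ_[p]) ^ M) * x k = (((D k).k - 2 : ℤ) : ℤ_[p])) ∧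
        (∀ k : ℕ, Function.Surjective (algebraMap ℤ_[p] (padicCoeffIntegers (D k).ι))) →
      ∃ F : PowerSeries (PowerSeries (unrIntegers p)),
        ¬ (PowerSeries.C (PowerSeries.X : PowerSeries (unrIntegers p)) ∣ F) ∧
        (∃ j : ℕ, PowerSeries.C ((p : 𝓞_ℂ_[p]) ^ j) *
            PowerSeries.map (R1.unrToCpInt p) (PowerSeries.map (PowerSeries.constantCoeff (R := unrIntegers p)) F) ∈
          (XAc.charIdeal (W.baseChange K) p κ 𝔭bar ∅ γ).map (PowerSeries.map (R1.toCpInt p))) ∧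
        ∃ bad : Set ℤ_[p], bad.Finite ∧ ∀ k : ℕ, x k ∉ bad → ∃ Φ : UnrSeries p,
          (∃ G U : PowerSeries (PowerSeries (unrIntegers p)),
            PowerSeries.map (PowerSeries.C (R := unrIntegers p)) Φ =
              F * G + PowerSeries.C (PowerSeries.X - PowerSeries.C (toUnr p (x k))) * U) ∧
          ∀ (b : padicCoeffIntegers (D k).ι →+* 𝓞_ℂ_[p]),
            (∀ y, ((b y : 𝓞_ℂ_[p]) : ℂ_[p]) =
              algebraMap (PadicAlgCl p) ℂ_[p] (padicCoeffIntegers.toPadicAlgCl (D k).ι y)) →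
          ∀ [TopologicalSpace (PowerSeries (padicCoeffIntegers (D k).ι))]
            [ContinuousSMul (PowerSeries (padicCoeffIntegers (D k).ι))
              (BigRepModule (padicCoeffIntegers (D k).ι) p (Cofree (D k).Δ.selfDualRep (padicCoeffField (D k).ι)))],
            ∃ j : ℕ, Ideal.span {PowerSeries.C ((p : 𝓞_ℂ_[p]) ^ j)} *
                (XBig.charIdeal κ ((D k).Δ.selfDualCofreeRepOver K) 𝔭bar
                  (∅ : Set (HeightOneSpectrum (𝓞 K)))).map (PowerSeries.map b) ≤
              Ideal.span {PowerSeries.map (R1.unrToCpInt p) Φ}) :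
    ∀ (W : WeierstrassCurve ℚ) [W.IsElliptic] [W.IsGloballyMinimal] (p : ℕ) [Fact p.Prime],
    ∀ (N : ℕ) [NeZero N] (K : Type) [Field K] [NumberField K] (Dt : ModularParametrizationData W N)
      (H : HeegnerDatum N (NumberField.discr K)) (ιK : K →+* ℂ) (P : (W.baseChange K).toAffine.Point),
      CellC W p → W.conductorNorm ℤ = N →
      IsImaginaryQuadratic K → NumberField.discr K < -4 → SatisfiesHeegnerHypothesis N K →
      (W.quadraticTwist (NumberField.discr K : ℚ)).entireLFunction 1 ≠ 0 →
      WeierstrassCurve.Affine.Point.map ιK.toRatAlgHom P = heegnerPointComplex Dt H →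
      ¬ (p : ℤ) ∣ Dt.c → ¬ IsOfFinAddOrder P →
      Odd (NumberField.discr K) →
      ∀ (κ : ZpExtension K p), κ.IsAnticyclotomic →
        ∀ (γ : Field.absoluteGaloisGroup K) [Fact (κ.IsTopGenerator γ)]
          (𝔭 : HeightOneSpectrum (𝓞 K)), ((p : ℕ) : 𝓞 K) ∈ 𝔭.asIdeal →
          𝔭.asIdeal.ramificationIdx (𝓞 ℚ) = 1 → 𝔭.asIdeal.inertiaDeg (𝓞 ℚ) = 1 →
          ∀ (𝔭bar : HeightOneSpectrum (𝓞 K)), ((p : ℕ) : 𝓞 K) ∈ 𝔭bar.asIdeal → 𝔭bar ≠ 𝔭 →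
            ((Ideal.span {(p : ℤ)}).primesOver (𝓞 K)).ncard = 2 →
          ∀ (f : CuspForm (CongruenceSubgroup.Gamma0 N) 2), IsNewformOf W f →
            ∀ (ι' : PadicAlgCl p ≃+* ℂ),
              (∀ (w : InfinitePlace K) (k : 𝓞 K),
                k ∈ 𝔭.asIdeal ↔ ‖ι'.symm (w.embedding (k : K))‖ < 1) →
              ∀ (ΩK : ℂ) (Ωp : ℂ_[p]) (Q : PowerSeries 𝓞_ℂ_[p]), ΩK ≠ 0 → ‖Ωp‖ = 1 →
                R1.IsBDPLFunctionInt p ι' 𝔭 κ γ f ΩK Ωp Q →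
      ∃ (F L : PowerSeries (PowerSeries (unrIntegers p))) (x : ℕ → ℤ_[p]),
        (∀ k, ‖x k‖ < 1) ∧ Filter.Tendsto x Filter.atTop (nhds 0) ∧
        ¬ (PowerSeries.C (PowerSeries.X : PowerSeries (unrIntegers p)) ∣ F) ∧
        (∃ j : ℕ, PowerSeries.C ((p : 𝓞_ℂ_[p]) ^ j) *
            PowerSeries.map (R1.unrToCpInt p) (PowerSeries.map (PowerSeries.constantCoeff (R := unrIntegers p)) F) ∈
          (XAc.charIdeal (W.baseChange K) p κ 𝔭bar ∅ γ).map (PowerSeries.map (R1.toCpInt p))) ∧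
        (∃ e : ℕ, PowerSeries.C ((p : 𝓞_ℂ_[p]) ^ e) * Q ∈
          Ideal.span {PowerSeries.map (R1.unrToCpInt p) (PowerSeries.map (PowerSeries.constantCoeff (R := unrIntegers p)) L)}) ∧
        ∀ k : ℕ, ∃ (D : Skinner2016.HidaCongruentForm W p 1),
          (∀ y : coeffField D.g, ι' (D.ι y) = (y : ℂ)) ∧ 2 * ((p : ℤ) - 1) ∣ D.k - 2 ∧
          ∃ (ΩKg : ℂ) (Ωpg : ℂ_[p]) (Lg : UnrSeries p), ΩKg ≠ 0 ∧ ‖Ωpg‖ = 1 ∧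
            IsBDPLFunctionWt ι' 𝔭 κ γ D.g ΩKg Ωpg Lg ∧
          ∃ (Φ Ψ : UnrSeries p),
            (∃ G U : PowerSeries (PowerSeries (unrIntegers p)),
              PowerSeries.map (PowerSeries.C (R := unrIntegers p)) Φ =
                F * G + PowerSeries.C (PowerSeries.X - PowerSeries.C (toUnr p (x k))) * U) ∧
            (∃ U : PowerSeries (PowerSeries (unrIntegers p)),
              PowerSeries.map (PowerSeries.C (R := unrIntegers p)) Ψ =
                L + PowerSeries.C (PowerSeries.X - PowerSeries.C (toUnr p (x k))) * U) ∧
            (∃ e : ℕ, PowerSeries.C ((p : 𝓞_ℂ_[p]) ^ e) * PowerSeries.map (R1.unrToCpInt p) Ψ ∈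
              Ideal.span {PowerSeries.map (R1.unrToCpInt p) Lg}) ∧
            ∀ (b : padicCoeffIntegers D.ι →+* 𝓞_ℂ_[p]),
              (∀ y, ((b y : 𝓞_ℂ_[p]) : ℂ_[p]) =
                algebraMap (PadicAlgCl p) ℂ_[p] (padicCoeffIntegers.toPadicAlgCl D.ι y)) →
            ∀ [TopologicalSpace (PowerSeries (padicCoeffIntegers D.ι))]
              [ContinuousSMul (PowerSeries (padicCoeffIntegers D.ι))
                (BigRepModule (padicCoeffIntegers D.ι) p (Cofree D.Δ.selfDualRep (padicCoeffField D.ι)))],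
              ∃ j : ℕ, Ideal.span {PowerSeries.C ((p : 𝓞_ℂ_[p]) ^ j)} *
                  (XBig.charIdeal κ (D.Δ.selfDualCofreeRepOver K) 𝔭bar
                    (∅ : Set (HeightOneSpectrum (𝓞 K)))).map (PowerSeries.map b) ≤
                Ideal.span {PowerSeries.map (R1.unrToCpInt p) Φ} := by
  intro W _ _ p _ N _ K _ _ Dt H ιK P hC hN hK hdisc hHeeg hL1 hP hc hfin hodd κ hκ γ _ 𝔭 h𝔭 hram hdeg 𝔭bar
    h𝔭bar hne hsp f hf ι' hι' ΩK Ωp Q hΩK hΩp hQ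
  obtain ⟨L, x, D, hpkg⟩ :=
    hAn W p N K Dt H ιK P hC hN hK hdisc hHeeg hL1 hP hc hfin hodd κ hκ γ 𝔭 h𝔭 hram hdeg 𝔭bar h𝔭bar hne
      hsp f hf ι' hι' ΩK Ωp Q hΩK hΩp hQ
  obtain ⟨hxk, hconv, hinf, han, hmem, hA, hwt, hrat⟩ := hpkg
  obtain ⟨F, hF, halg, bad, hbad, hfib⟩ :=
    hAlg W p N K Dt H ιK P hC hN hK hdisc hHeeg hL1 hP hc hfin hodd κ hκ γ 𝔭 h𝔭 hram hdeg 𝔭bar h𝔭bar hne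
      hsp f hf ι' hι' ΩK Ωp Q hΩK hΩp hQ L x D ⟨hxk, hconv, han, hmem, hA, hwt, hrat⟩
  -- the members off the exceptional set form an infinite set of indices (range `x` infinite, `bad` finite)
  have hS : {k : ℕ | x k ∉ bad}.Infinite := by
    intro hSfin
    apply hinf
    have hsub : Set.range x ⊆ x '' {k : ℕ | x k ∉ bad} ∪ bad := by
      rintro _ ⟨k, rfl⟩
      by_cases hk : x k ∈ bad
      · exact Or.inr hk
      · exact Or.inl ⟨k, hk, rfl⟩
    exact ((hSfin.image x).union hbad).subset hsub
  -- enumerate it increasingly: the subsequence `φ`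
  have hφmono : StrictMono (Nat.nth (fun k : ℕ => x k ∉ bad)) := Nat.nth_strictMono hS
  have hφmem : ∀ i : ℕ, x (Nat.nth (fun k : ℕ => x k ∉ bad) i) ∉ bad := fun i => Nat.nth_mem_of_infinite hS i
  refine ⟨F, L, x ∘ Nat.nth (fun k : ℕ => x k ∉ bad), fun k => hxk _, hconv.comp hφmono.tendsto_atTop, hF, halg, han,
    fun k => ?_⟩
  obtain ⟨hDι, hpar, ΩKg, Ωpg, Lg, hΩKg, hΩpg, hLg, Ψ, hΨ, he⟩ := hmem (Nat.nth (fun k : ℕ => x k ∉ bad) k)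
  obtain ⟨Φ, hΦ, hchar⟩ := hfib (Nat.nth (fun k : ℕ => x k ∉ bad) k) (hφmem k)
  exact ⟨D (Nat.nth (fun k : ℕ => x k ∉ bad) k), hDι, hpar, ΩKg, Ωpg, Lg, hΩKg, hΩpg, hLg, Φ, Ψ, hΦ, hΨ, he, hchar⟩

end Summit.BirchSwinnertonDyer.BirchSwinnertonDyer.Theorems.TelescopeCarrierOfAnDistRatOfAlgFP

end
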